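import Literature.Geometry.Lorentzian.KerrOblateCalculus
import Literature.Geometry.Lorentzian.KerrNullShearFree
import Literature.Geometry.Lorentzian.KerrRpCoercivity
import Literature.Geometry.Lorentzian.KerrSchildCoord
import HarnessLib

/-!
# Kerr is Ricci-flat, 0: second directional derivatives of `r`, `H`, `ℓ_μ` and `g_{μν}`

Support file for the stub `stub_kerrVacuum` (the Kerr metric in ingoing Kerr–Schild coordinates is
Ricci-flat, `Kerr.isRicciFlat`; line `tapered-temporal-collar`, crux `stmt-FinalStateConjecture-10054`).
At a point with Kerr–Schild radius `r > 0`, for constant directions `v, w`: `∂_v∂_w r`, `∂_v∂_w H`,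
`∂_v∂_w ℓ_μ` from the prelude's first-order closed forms (`Kerr.fderiv_radius_apply`,
`Kerr.fderiv_scalarH_apply`, `Kerr.fderiv_nullCovectorFun_one/two/three`) as line derivatives along
`t ↦ x + tv`. Kerr–Schild 1965, §§2–3; Visser arXiv:0706.0622, (32)–(36).
-/

set_option linter.dupNamespace false
-- instance search through the nested operator types `E4 →L E4 →L E4 →L ℝ`
set_option maxSynthPendingDepth 3

noncomputable section

open Set Filter
open scoped Topology
open Literature.Geometry.Lorentzian

namespace Summit.FinalStateConjecture.FinalStateConjecture.Theorems.SwallowTheDatum.KerrShieldedSettles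

namespace StubKerrVacuum

variable {a : ℝ} {x : E4}

/-- The coordinate functions along a line: `t ↦ (x + t v)^μ = x^μ + t v^μ` has derivative `v^μ`.
[folklore] -/
theorem hasDerivAt_coord_line (x v : E4) (μ : Fin 4) :
    HasDerivAt (fun t : ℝ ↦ x μ + t * v μ) (v μ) 0 := by
  simpa using ((hasDerivAt_id (0 : ℝ)).mul_const (v μ)).const_add (x μ)

/-- Along a line, `t ↦ dr_{x + tv}(w)` has derivative `∂_v (y ↦ dr_y(w))(x)` at `t = 0` (the
radius is `C^∞` where it is positive). [folklore] -/
theorem hasDerivAt_fderiv_radius_line (hx : 0 < Kerr.radius a x) (v w : E4) :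
    HasDerivAt (fun t : ℝ ↦ fderiv ℝ (Kerr.radius a) (x + t • v) w)
      (fderiv ℝ (fun y ↦ fderiv ℝ (Kerr.radius a) y w) x v) 0 :=
  (Kerr.differentiableAt_fderiv_radius_apply hx w).hasFDerivAt.hasLineDerivAt v

/-- `y ↦ ∂_w H(y)` is differentiable wherever `r > 0` (`H` is `C^∞` there). [folklore] -/
theorem differentiableAt_fderiv_scalarH_apply (M : ℝ) (hx : 0 < Kerr.radius a x) (w : E4) :
    DifferentiableAt ℝ (fun y ↦ fderiv ℝ (Kerr.scalarH M a) y w) x := by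
  have h2 : DifferentiableAt ℝ (fderiv ℝ (Kerr.scalarH M a)) x :=
    ((Kerr.contDiffAt_scalarH M a hx (n := 2)).fderiv_right (m := 1) le_rfl).differentiableAt
      one_ne_zero
  exact h2.clm_apply (differentiableAt_const w)

/-- `y ↦ ∂_w ℓ_μ(y)` is differentiable wherever `r > 0` (`ℓ_μ` is `C^∞` there). [folklore] -/
theorem differentiableAt_fderiv_nullCovectorFun_apply (hx : 0 < Kerr.radius a x) (μ : Fin 4)
    (w : E4) :
    DifferentiableAt ℝ (fun y ↦ fderiv ℝ (fun z ↦ Kerr.nullCovectorFun a z μ) y w) x := by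
  have h2 : DifferentiableAt ℝ (fderiv ℝ (fun z ↦ Kerr.nullCovectorFun a z μ)) x :=
    ((Kerr.contDiffAt_nullCovectorFun a hx (n := 2) μ).fderiv_right (m := 1) le_rfl).differentiableAt
      one_ne_zero
  exact h2.clm_apply (differentiableAt_const w)

/-- `Σ = 2r² − |x⃗|² + a²` along the line `t ↦ x + t v`, as a polynomial in `t` and `r(x + tv)`.
[cite: arXiv07060622, (35)] -/
theorem blSigma_line (a : ℝ) (x v : E4) (t : ℝ) :
    Kerr.blSigma a (E4.spatial (x + t • v)) =
      2 * Kerr.radius a (x + t • v) ^ 2 -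
        ((x 1 + t * v 1) ^ 2 + (x 2 + t * v 2) ^ 2 + (x 3 + t * v 3) ^ 2) + a ^ 2 := by
  rw [Kerr.blSigma_spatial_eq, E4.spatialNorm_sq, Kerr.add_smul_apply', Kerr.add_smul_apply',
    Kerr.add_smul_apply']

/-- The line derivative of `Σ(x + tv) = 2r² − |x⃗ + t v⃗|² + a²` at `t = 0`:
`4 r dr(v) − 2 x⃗·v⃗`. [cite: arXiv07060622, (35)] -/
theorem hasDerivAt_blSigma_line (hx : 0 < Kerr.radius a x) (v : E4) :
    HasDerivAt (fun t : ℝ ↦ 2 * Kerr.radius a (x + t • v) ^ 2 -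
        ((x 1 + t * v 1) ^ 2 + (x 2 + t * v 2) ^ 2 + (x 3 + t * v 3) ^ 2) + a ^ 2)
      (4 * Kerr.radius a x * fderiv ℝ (Kerr.radius a) x v -
        2 * (x 1 * v 1 + x 2 * v 2 + x 3 * v 3)) 0 := by
  have hr := Kerr.hasDerivAt_radius_line hx v
  have hl := hasDerivAt_coord_line x v
  have h := (((hr.pow 2).const_mul 2).sub ((((hl 1).pow 2).add ((hl 2).pow 2)).add
    ((hl 3).pow 2))).add_const (a ^ 2)
  refine h.congr_deriv ?_
  simp only [zero_smul, add_zero, Nat.cast_ofNat, zero_mul, pow_one, Nat.add_one_sub_one]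
  ring

/-- **The second directional derivatives of the Kerr–Schild radius**: the quotient rule on
`dr(w) = N_w/(rΣ)`, `N_w = r²(w⃗·x⃗) + a² z w³` (`Kerr.fderiv_radius_apply`) along `t ↦ x + tv`,
`∂_v(rΣ) = dr(v)Σ + r(4r dr(v) − 2x⃗·v⃗)`. [cite: arXiv07060622, (35)] -/
theorem fderiv_fderiv_radius (hx : 0 < Kerr.radius a x) (v w : E4) :
    fderiv ℝ (fun y ↦ fderiv ℝ (Kerr.radius a) y w) x v =
      ((2 * Kerr.radius a x * fderiv ℝ (Kerr.radius a) x v * (w 1 * x 1 + w 2 * x 2 + w 3 * x 3) +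
            Kerr.radius a x ^ 2 * (w 1 * v 1 + w 2 * v 2 + w 3 * v 3) + a ^ 2 * v 3 * w 3) *
          (Kerr.radius a x * Kerr.blSigma a (E4.spatial x)) -
        (Kerr.radius a x ^ 2 * (w 1 * x 1 + w 2 * x 2 + w 3 * x 3) + a ^ 2 * x 3 * w 3) *
          (fderiv ℝ (Kerr.radius a) x v * Kerr.blSigma a (E4.spatial x) +
            Kerr.radius a x * (4 * Kerr.radius a x * fderiv ℝ (Kerr.radius a) x v -
              2 * (x 1 * v 1 + x 2 * v 2 + x 3 * v 3)))) /
        (Kerr.radius a x * Kerr.blSigma a (E4.spatial x)) ^ 2 := by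
  have hD : Kerr.radius a x * Kerr.blSigma a (E4.spatial x) ≠ 0 :=
    mul_ne_zero hx.ne' (Kerr.blSigma_spatial_pos hx).ne'
  have h1 : HasLineDerivAt ℝ (fun y ↦ fderiv ℝ (Kerr.radius a) y w)
      (fderiv ℝ (fun y ↦ fderiv ℝ (Kerr.radius a) y w) x v) x v :=
    (Kerr.differentiableAt_fderiv_radius_apply hx w).hasFDerivAt.hasLineDerivAt _
  refine h1.unique ?_
  show HasDerivAt (fun t : ℝ ↦ fderiv ℝ (Kerr.radius a) (x + t • v) w) _ 0
  have hr := Kerr.hasDerivAt_radius_line hx v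
  have hl := hasDerivAt_coord_line x v
  -- the explicit quotient along the line, valid near `t = 0`
  have hev : (fun t : ℝ ↦ fderiv ℝ (Kerr.radius a) (x + t • v) w) =ᶠ[𝓝 0] fun t ↦
      (Kerr.radius a (x + t • v) ^ 2 * (w 1 * (x 1 + t * v 1) + w 2 * (x 2 + t * v 2) +
          w 3 * (x 3 + t * v 3)) + a ^ 2 * (x 3 + t * v 3) * w 3) /
        (Kerr.radius a (x + t • v) * (2 * Kerr.radius a (x + t • v) ^ 2 -
          ((x 1 + t * v 1) ^ 2 + (x 2 + t * v 2) ^ 2 + (x 3 + t * v 3) ^ 2) + a ^ 2)) := by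
    filter_upwards [Kerr.eventually_radius_line_pos hx v] with t ht
    rw [Kerr.fderiv_radius_apply ht w, blSigma_line, Kerr.add_smul_apply', Kerr.add_smul_apply',
      Kerr.add_smul_apply']
  have hlin : HasDerivAt (fun t : ℝ ↦ w 1 * (x 1 + t * v 1) + w 2 * (x 2 + t * v 2) +
      w 3 * (x 3 + t * v 3)) (w 1 * v 1 + w 2 * v 2 + w 3 * v 3) 0 :=
    (((hl 1).const_mul (w 1)).add ((hl 2).const_mul (w 2))).add ((hl 3).const_mul (w 3))
  have hnum := ((hr.pow 2).mul hlin).add (((hl 3).const_mul (a ^ 2)).mul_const (w 3))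
  have hden := hr.mul (hasDerivAt_blSigma_line hx v)
  have hden0 : Kerr.radius a (x + (0 : ℝ) • v) * (2 * Kerr.radius a (x + (0 : ℝ) • v) ^ 2 -
      ((x 1 + 0 * v 1) ^ 2 + (x 2 + 0 * v 2) ^ 2 + (x 3 + 0 * v 3) ^ 2) + a ^ 2) ≠ 0 := by
    simpa [Kerr.blSigma_spatial_eq, E4.spatialNorm_sq] using hD
  have hdiv := hnum.div hden hden0
  refine (hdiv.congr_of_eventuallyEq hev).congr_deriv ?_
  simp only [Pi.mul_apply, Pi.add_apply, Pi.pow_apply, zero_smul, add_zero, Nat.cast_ofNat, zero_mul, pow_one, Nat.add_one_sub_one]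
  rw [Kerr.blSigma_spatial_eq, E4.spatialNorm_sq]

set_option maxRecDepth 4096 in
/-- **The second directional derivatives of `H`**: differentiate the closed form
`∂_w H = M (dr(w) Σ − r(4r dr(w) − 2 x⃗·w⃗))/Σ²` (`Kerr.fderiv_scalarH_apply`) along `t ↦ x + tv`;
the result is expressed through `∂_v∂_w r` (`fderiv_fderiv_radius`), `dr(v)`, `dr(w)`, `r`, `Σ`.
[cite: arXiv07060622, (33)] -/
theorem fderiv_fderiv_scalarH (M : ℝ) (hx : 0 < Kerr.radius a x) (v w : E4) :
    fderiv ℝ (fun y ↦ fderiv ℝ (Kerr.scalarH M a) y w) x v =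
      (M * (fderiv ℝ (fun y ↦ fderiv ℝ (Kerr.radius a) y w) x v * Kerr.blSigma a (E4.spatial x) +
              fderiv ℝ (Kerr.radius a) x w * (4 * Kerr.radius a x * fderiv ℝ (Kerr.radius a) x v -
                2 * (x 1 * v 1 + x 2 * v 2 + x 3 * v 3)) -
            (fderiv ℝ (Kerr.radius a) x v * (4 * Kerr.radius a x * fderiv ℝ (Kerr.radius a) x w -
                2 * (x 1 * w 1 + x 2 * w 2 + x 3 * w 3)) +
              Kerr.radius a x * (4 * fderiv ℝ (Kerr.radius a) x v * fderiv ℝ (Kerr.radius a) x w +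
                4 * Kerr.radius a x * fderiv ℝ (fun y ↦ fderiv ℝ (Kerr.radius a) y w) x v -
                2 * (v 1 * w 1 + v 2 * w 2 + v 3 * w 3)))) *
          Kerr.blSigma a (E4.spatial x) ^ 2 -
        M * (fderiv ℝ (Kerr.radius a) x w * Kerr.blSigma a (E4.spatial x) -
            Kerr.radius a x * (4 * Kerr.radius a x * fderiv ℝ (Kerr.radius a) x w -
              2 * (x 1 * w 1 + x 2 * w 2 + x 3 * w 3))) *
          (2 * Kerr.blSigma a (E4.spatial x) * (4 * Kerr.radius a x * fderiv ℝ (Kerr.radius a) x v -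
            2 * (x 1 * v 1 + x 2 * v 2 + x 3 * v 3)))) /
        (Kerr.blSigma a (E4.spatial x) ^ 2) ^ 2 := by
  have hS : Kerr.blSigma a (E4.spatial x) ≠ 0 := (Kerr.blSigma_spatial_pos hx).ne'
  have h1 : HasLineDerivAt ℝ (fun y ↦ fderiv ℝ (Kerr.scalarH M a) y w)
      (fderiv ℝ (fun y ↦ fderiv ℝ (Kerr.scalarH M a) y w) x v) x v :=
    (differentiableAt_fderiv_scalarH_apply M hx w).hasFDerivAt.hasLineDerivAt _
  refine h1.unique ?_
  show HasDerivAt (fun t : ℝ ↦ fderiv ℝ (Kerr.scalarH M a) (x + t • v) w) _ 0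
  have hr := Kerr.hasDerivAt_radius_line hx v
  have hl := hasDerivAt_coord_line x v
  have hφ := hasDerivAt_fderiv_radius_line hx v w
  have hev : (fun t : ℝ ↦ fderiv ℝ (Kerr.scalarH M a) (x + t • v) w) =ᶠ[𝓝 0] fun t ↦
      M * (fderiv ℝ (Kerr.radius a) (x + t • v) w *
            (2 * Kerr.radius a (x + t • v) ^ 2 -
              ((x 1 + t * v 1) ^ 2 + (x 2 + t * v 2) ^ 2 + (x 3 + t * v 3) ^ 2) + a ^ 2) -
          Kerr.radius a (x + t • v) * (4 * Kerr.radius a (x + t • v) *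
              fderiv ℝ (Kerr.radius a) (x + t • v) w -
            2 * ((x 1 + t * v 1) * w 1 + (x 2 + t * v 2) * w 2 + (x 3 + t * v 3) * w 3))) /
        (2 * Kerr.radius a (x + t • v) ^ 2 -
          ((x 1 + t * v 1) ^ 2 + (x 2 + t * v 2) ^ 2 + (x 3 + t * v 3) ^ 2) + a ^ 2) ^ 2 := by
    filter_upwards [Kerr.eventually_radius_line_pos hx v] with t ht
    rw [Kerr.fderiv_scalarH_apply M ht w, blSigma_line, Kerr.add_smul_apply', Kerr.add_smul_apply',
      Kerr.add_smul_apply']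
  have hSl := hasDerivAt_blSigma_line hx v
  have hlin : HasDerivAt (fun t : ℝ ↦ (x 1 + t * v 1) * w 1 + (x 2 + t * v 2) * w 2 +
      (x 3 + t * v 3) * w 3) (v 1 * w 1 + v 2 * w 2 + v 3 * w 3) 0 :=
    (((hl 1).mul_const (w 1)).add ((hl 2).mul_const (w 2))).add ((hl 3).mul_const (w 3))
  have hA := (hφ.mul hSl).sub (hr.mul (((hr.const_mul 4).mul hφ).sub (hlin.const_mul 2)))
  have hden0 : (2 * Kerr.radius a (x + (0 : ℝ) • v) ^ 2 -
      ((x 1 + 0 * v 1) ^ 2 + (x 2 + 0 * v 2) ^ 2 + (x 3 + 0 * v 3) ^ 2) + a ^ 2) ^ 2 ≠ 0 := by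
    simpa [Kerr.blSigma_spatial_eq, E4.spatialNorm_sq] using pow_ne_zero 2 hS
  have hdiv := (hA.const_mul M).div (hSl.pow 2) hden0
  refine (hdiv.congr_of_eventuallyEq hev).congr_deriv ?_
  simp only [Pi.mul_apply, Pi.sub_apply, Pi.pow_apply, zero_smul, add_zero, Nat.cast_ofNat, zero_mul, pow_one, Nat.add_one_sub_one]
  rw [Kerr.blSigma_spatial_eq, E4.spatialNorm_sq]

/-- **The second directional derivatives of `ℓ₁ = (r x + a y)/(r² + a²)`**: differentiate the
closed form of `∂_w ℓ₁` (`Kerr.fderiv_nullCovectorFun_one`) along `t ↦ x + tv`; expressed through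
`∂_v∂_w r`, `dr(v)`, `dr(w)`, `r`. [cite: arXiv07060622, (34)] -/
theorem fderiv_fderiv_nullCovectorFun_one (hx : 0 < Kerr.radius a x) (v w : E4) :
    fderiv ℝ (fun y ↦ fderiv ℝ (fun z ↦ Kerr.nullCovectorFun a z 1) y w) x v =
      (((fderiv ℝ (Kerr.radius a) x w * v 1 +
                fderiv ℝ (fun y ↦ fderiv ℝ (Kerr.radius a) y w) x v * x 1 +
              fderiv ℝ (Kerr.radius a) x v * w 1) * (Kerr.radius a x ^ 2 + a ^ 2) +
            (fderiv ℝ (Kerr.radius a) x w * x 1 + Kerr.radius a x * w 1 + a * w 2) *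
              (2 * Kerr.radius a x * fderiv ℝ (Kerr.radius a) x v) -
            ((fderiv ℝ (Kerr.radius a) x v * x 1 + Kerr.radius a x * v 1 + a * v 2) *
                (2 * Kerr.radius a x * fderiv ℝ (Kerr.radius a) x w) +
              (Kerr.radius a x * x 1 + a * x 2) *
                (2 * fderiv ℝ (Kerr.radius a) x v * fderiv ℝ (Kerr.radius a) x w +
                  2 * Kerr.radius a x * fderiv ℝ (fun y ↦ fderiv ℝ (Kerr.radius a) y w) x v))) *
          ((Kerr.radius a x ^ 2 + a ^ 2) ^ 2) -
        ((fderiv ℝ (Kerr.radius a) x w * x 1 + Kerr.radius a x * w 1 + a * w 2) *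
              (Kerr.radius a x ^ 2 + a ^ 2) -
            (Kerr.radius a x * x 1 + a * x 2) * (2 * Kerr.radius a x * fderiv ℝ (Kerr.radius a) x w)) *
          (2 * (Kerr.radius a x ^ 2 + a ^ 2) * (2 * Kerr.radius a x * fderiv ℝ (Kerr.radius a) x v))) /
        ((Kerr.radius a x ^ 2 + a ^ 2) ^ 2) ^ 2 := by
  have hP : Kerr.radius a x ^ 2 + a ^ 2 ≠ 0 := by positivity
  have h1 : HasLineDerivAt ℝ (fun y ↦ fderiv ℝ (fun z ↦ Kerr.nullCovectorFun a z 1) y w)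
      (fderiv ℝ (fun y ↦ fderiv ℝ (fun z ↦ Kerr.nullCovectorFun a z 1) y w) x v) x v :=
    (differentiableAt_fderiv_nullCovectorFun_apply hx 1 w).hasFDerivAt.hasLineDerivAt _
  refine h1.unique ?_
  show HasDerivAt (fun t : ℝ ↦ fderiv ℝ (fun z ↦ Kerr.nullCovectorFun a z 1) (x + t • v) w) _ 0
  have hr := Kerr.hasDerivAt_radius_line hx v
  have hl := hasDerivAt_coord_line x v
  have hφ := hasDerivAt_fderiv_radius_line hx v w
  have hev : (fun t : ℝ ↦ fderiv ℝ (fun z ↦ Kerr.nullCovectorFun a z 1) (x + t • v) w) =ᶠ[𝓝 0]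
      fun t ↦ ((fderiv ℝ (Kerr.radius a) (x + t • v) w * (x 1 + t * v 1) +
          Kerr.radius a (x + t • v) * w 1 + a * w 2) * (Kerr.radius a (x + t • v) ^ 2 + a ^ 2) -
        (Kerr.radius a (x + t • v) * (x 1 + t * v 1) + a * (x 2 + t * v 2)) *
          (2 * Kerr.radius a (x + t • v) * fderiv ℝ (Kerr.radius a) (x + t • v) w)) /
        (Kerr.radius a (x + t • v) ^ 2 + a ^ 2) ^ 2 := by
    filter_upwards [Kerr.eventually_radius_line_pos hx v] with t ht
    rw [Kerr.fderiv_nullCovectorFun_one ht w, Kerr.add_smul_apply', Kerr.add_smul_apply']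
  have hB := ((hφ.mul (hl 1)).add (hr.mul_const (w 1))).add_const (a * w 2)
  have hPl := (hr.pow 2).add_const (a ^ 2)
  have hC := (hr.mul (hl 1)).add ((hl 2).const_mul a)
  have hE := (hr.const_mul 2).mul hφ
  have hnum := (hB.mul hPl).sub (hC.mul hE)
  have hden0 : (Kerr.radius a (x + (0 : ℝ) • v) ^ 2 + a ^ 2) ^ 2 ≠ 0 := by
    simpa using pow_ne_zero 2 hP
  have hdiv := hnum.div (hPl.pow 2) hden0
  refine (hdiv.congr_of_eventuallyEq hev).congr_deriv ?_
  simp only [Pi.mul_apply, Pi.add_apply, Pi.sub_apply, Pi.pow_apply, zero_smul, add_zero, Nat.cast_ofNat, zero_mul, pow_one, Nat.add_one_sub_one]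
  ring

/-- **The second directional derivatives of `ℓ₂ = (r y − a x)/(r² + a²)`**
(`Kerr.fderiv_nullCovectorFun_two` differentiated along `t ↦ x + tv`). [cite: arXiv07060622, (34)] -/
theorem fderiv_fderiv_nullCovectorFun_two (hx : 0 < Kerr.radius a x) (v w : E4) :
    fderiv ℝ (fun y ↦ fderiv ℝ (fun z ↦ Kerr.nullCovectorFun a z 2) y w) x v =
      (((fderiv ℝ (Kerr.radius a) x w * v 2 +
                fderiv ℝ (fun y ↦ fderiv ℝ (Kerr.radius a) y w) x v * x 2 +
              fderiv ℝ (Kerr.radius a) x v * w 2) * (Kerr.radius a x ^ 2 + a ^ 2) +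
            (fderiv ℝ (Kerr.radius a) x w * x 2 + Kerr.radius a x * w 2 - a * w 1) *
              (2 * Kerr.radius a x * fderiv ℝ (Kerr.radius a) x v) -
            ((fderiv ℝ (Kerr.radius a) x v * x 2 + Kerr.radius a x * v 2 - a * v 1) *
                (2 * Kerr.radius a x * fderiv ℝ (Kerr.radius a) x w) +
              (Kerr.radius a x * x 2 - a * x 1) *
                (2 * fderiv ℝ (Kerr.radius a) x v * fderiv ℝ (Kerr.radius a) x w +
                  2 * Kerr.radius a x * fderiv ℝ (fun y ↦ fderiv ℝ (Kerr.radius a) y w) x v))) *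
          ((Kerr.radius a x ^ 2 + a ^ 2) ^ 2) -
        ((fderiv ℝ (Kerr.radius a) x w * x 2 + Kerr.radius a x * w 2 - a * w 1) *
              (Kerr.radius a x ^ 2 + a ^ 2) -
            (Kerr.radius a x * x 2 - a * x 1) * (2 * Kerr.radius a x * fderiv ℝ (Kerr.radius a) x w)) *
          (2 * (Kerr.radius a x ^ 2 + a ^ 2) * (2 * Kerr.radius a x * fderiv ℝ (Kerr.radius a) x v))) /
        ((Kerr.radius a x ^ 2 + a ^ 2) ^ 2) ^ 2 := by
  have hP : Kerr.radius a x ^ 2 + a ^ 2 ≠ 0 := by positivity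
  have h1 : HasLineDerivAt ℝ (fun y ↦ fderiv ℝ (fun z ↦ Kerr.nullCovectorFun a z 2) y w)
      (fderiv ℝ (fun y ↦ fderiv ℝ (fun z ↦ Kerr.nullCovectorFun a z 2) y w) x v) x v :=
    (differentiableAt_fderiv_nullCovectorFun_apply hx 2 w).hasFDerivAt.hasLineDerivAt _
  refine h1.unique ?_
  show HasDerivAt (fun t : ℝ ↦ fderiv ℝ (fun z ↦ Kerr.nullCovectorFun a z 2) (x + t • v) w) _ 0
  have hr := Kerr.hasDerivAt_radius_line hx v
  have hl := hasDerivAt_coord_line x v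
  have hφ := hasDerivAt_fderiv_radius_line hx v w
  have hev : (fun t : ℝ ↦ fderiv ℝ (fun z ↦ Kerr.nullCovectorFun a z 2) (x + t • v) w) =ᶠ[𝓝 0]
      fun t ↦ ((fderiv ℝ (Kerr.radius a) (x + t • v) w * (x 2 + t * v 2) +
          Kerr.radius a (x + t • v) * w 2 - a * w 1) * (Kerr.radius a (x + t • v) ^ 2 + a ^ 2) -
        (Kerr.radius a (x + t • v) * (x 2 + t * v 2) - a * (x 1 + t * v 1)) *
          (2 * Kerr.radius a (x + t • v) * fderiv ℝ (Kerr.radius a) (x + t • v) w)) /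
        (Kerr.radius a (x + t • v) ^ 2 + a ^ 2) ^ 2 := by
    filter_upwards [Kerr.eventually_radius_line_pos hx v] with t ht
    rw [Kerr.fderiv_nullCovectorFun_two ht w, Kerr.add_smul_apply', Kerr.add_smul_apply']
  have hB := ((hφ.mul (hl 2)).add (hr.mul_const (w 2))).sub_const (a * w 1)
  have hPl := (hr.pow 2).add_const (a ^ 2)
  have hC := (hr.mul (hl 2)).sub ((hl 1).const_mul a)
  have hE := (hr.const_mul 2).mul hφ
  have hnum := (hB.mul hPl).sub (hC.mul hE)
  have hden0 : (Kerr.radius a (x + (0 : ℝ) • v) ^ 2 + a ^ 2) ^ 2 ≠ 0 := by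
    simpa using pow_ne_zero 2 hP
  have hdiv := hnum.div (hPl.pow 2) hden0
  refine (hdiv.congr_of_eventuallyEq hev).congr_deriv ?_
  simp only [Pi.mul_apply, Pi.add_apply, Pi.sub_apply, Pi.pow_apply, zero_smul, add_zero, Nat.cast_ofNat, zero_mul, pow_one, Nat.add_one_sub_one]
  ring

/-- **The second directional derivatives of `ℓ₃ = z/r`** (`Kerr.fderiv_nullCovectorFun_three`
differentiated along `t ↦ x + tv`). [cite: arXiv07060622, (34)] -/
theorem fderiv_fderiv_nullCovectorFun_three (hx : 0 < Kerr.radius a x) (v w : E4) :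
    fderiv ℝ (fun y ↦ fderiv ℝ (fun z ↦ Kerr.nullCovectorFun a z 3) y w) x v =
      ((w 3 * fderiv ℝ (Kerr.radius a) x v -
            (v 3 * fderiv ℝ (Kerr.radius a) x w +
              x 3 * fderiv ℝ (fun y ↦ fderiv ℝ (Kerr.radius a) y w) x v)) * Kerr.radius a x ^ 2 -
          (w 3 * Kerr.radius a x - x 3 * fderiv ℝ (Kerr.radius a) x w) *
            (2 * Kerr.radius a x * fderiv ℝ (Kerr.radius a) x v)) /
        (Kerr.radius a x ^ 2) ^ 2 := by
  have h1 : HasLineDerivAt ℝ (fun y ↦ fderiv ℝ (fun z ↦ Kerr.nullCovectorFun a z 3) y w)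
      (fderiv ℝ (fun y ↦ fderiv ℝ (fun z ↦ Kerr.nullCovectorFun a z 3) y w) x v) x v :=
    (differentiableAt_fderiv_nullCovectorFun_apply hx 3 w).hasFDerivAt.hasLineDerivAt _
  refine h1.unique ?_
  show HasDerivAt (fun t : ℝ ↦ fderiv ℝ (fun z ↦ Kerr.nullCovectorFun a z 3) (x + t • v) w) _ 0
  have hr := Kerr.hasDerivAt_radius_line hx v
  have hl := hasDerivAt_coord_line x v
  have hφ := hasDerivAt_fderiv_radius_line hx v w
  have hev : (fun t : ℝ ↦ fderiv ℝ (fun z ↦ Kerr.nullCovectorFun a z 3) (x + t • v) w) =ᶠ[𝓝 0]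
      fun t ↦ (w 3 * Kerr.radius a (x + t • v) -
          (x 3 + t * v 3) * fderiv ℝ (Kerr.radius a) (x + t • v) w) /
        Kerr.radius a (x + t • v) ^ 2 := by
    filter_upwards [Kerr.eventually_radius_line_pos hx v] with t ht
    rw [Kerr.fderiv_nullCovectorFun_three ht w, Kerr.add_smul_apply']
  have hnum := (hr.const_mul (w 3)).sub ((hl 3).mul hφ)
  have hden0 : Kerr.radius a (x + (0 : ℝ) • v) ^ 2 ≠ 0 := by simpa using pow_ne_zero 2 hx.ne'
  have hdiv := hnum.div (hr.pow 2) hden0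
  refine (hdiv.congr_of_eventuallyEq hev).congr_deriv ?_
  simp only [Pi.mul_apply, Pi.sub_apply, Pi.pow_apply, zero_smul, add_zero, Nat.cast_ofNat, zero_mul, pow_one, Nat.add_one_sub_one]

end StubKerrVacuum

/-- **Registered sub-goal `stub_kerrVacuumD2Radius`** of stub `stub_kerrVacuum` (line
`tapered-temporal-collar`): the second directional derivatives of the Kerr–Schild radius wherever
`r > 0` (quotient rule on `dr(w) = N_w/(rΣ)`). [cite: arXiv07060622, (35)] -/
theorem stub_kerrVacuumD2Radius : ∀ (a : ℝ) (x : E4), 0 < Kerr.radius a x → ∀ (v w : E4),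
    fderiv ℝ (fun y ↦ fderiv ℝ (Kerr.radius a) y w) x v = ((2 * Kerr.radius a x
    * fderiv ℝ (Kerr.radius a) x v * (w 1 * x 1 + w 2 * x 2 + w 3 * x 3)
    + Kerr.radius a x ^ 2 * (w 1 * v 1 + w 2 * v 2 + w 3 * v 3)
    + a ^ 2 * v 3 * w 3) * (Kerr.radius a x * Kerr.blSigma a (E4.spatial x))
    - (Kerr.radius a x ^ 2 * (w 1 * x 1 + w 2 * x 2 + w 3 * x 3)
    + a ^ 2 * x 3 * w 3) * (fderiv ℝ (Kerr.radius a) x v * Kerr.blSigma a (E4.spatial x)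
    + Kerr.radius a x * (4 * Kerr.radius a x * fderiv ℝ (Kerr.radius a) x v - 2 * (x 1 * v 1
    + x 2 * v 2 + x 3 * v 3)))) / (Kerr.radius a x * Kerr.blSigma a (E4.spatial x)) ^ 2 :=
  fun _ _ hx v w ↦ StubKerrVacuum.fderiv_fderiv_radius hx v w

end Summit.FinalStateConjecture.FinalStateConjecture.Theorems.SwallowTheDatum.KerrShieldedSettles

end
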